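import Summits.BirchSwinnertonDyer.BirchSwinnertonDyer.Theses.VerticalContact
import Summits.BirchSwinnertonDyer.BirchSwinnertonDyer.Theorems.TamePinch.Negative.CMQuarticImage
import Literature.NumberTheory.EllipticCurves.PAdicHeightsProofs
import Literature.NumberTheory.EllipticCurves.ComplexMultiplicationHasCMProofs

/-!
# BirchSwinnertonDyer / VerticalContact — crux `PGSelmerBSD` (stmt-BirchSwinnertonDyer-17810):
# negative lemmas — the sector is inhabited (by a CM curve) and the ADMISSIBLE-prime
# strengthening of the crux is FALSE (standing disprover, cycle 1)

The crux (`Theses/VerticalContact.lean`) is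
`∀ W [IsElliptic] [IsGloballyMinimal], (¬ ∃ q prime, W.HasMultiplicativeReductionAtPrime q) →
   ∃ p prime, W.selmerCorank p = W.analyticRank` — one-prime Selmer-rank BSD on the potentially-good
sector. It is typed faithfully and is NOT refuted (it is implied by BSD-rank ∧ one-prime
Ш-finiteness; full adversarial record: `Cruxes/PGSelmerBSD/Disproof.lean`). This file lands, WITHOUT
asserting any route statement and without introducing a definition, the small-model facts behind
that record:

* `PGSelmerBSDNegative.not_exists_multiplicative_of_j_eq_intCast` — **integral `j` ⟹ in the sector**
  (no prime of multiplicative reduction), from the tree theorem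
  `WeierstrassCurve.one_lt_norm_j_of_hasMultiplicativeReductionAtPrime` (Silverman AEC VII.5.1(b):
  multiplicative reduction at `q` forces `‖j‖_q > 1`);
* `PGSelmerBSDNegative.j_quartic` — `j(y² = x³ + Dx) = 1728` (for the elliptic ones, `D ≠ 0`);
* `PGSelmerBSDNegative.thirtyTwoA2_no_multiplicative_prime`, `PGSelmerBSDNegative.hypotheses_satisfiable`,
  `PGSelmerBSDNegative.sector_meets_CM` — `32a2 : y² = x³ − x` is elliptic, globally minimal
  (`tamePinch_isGloballyMinimal_thirtyTwoA2`, REUSED), in the sector, and CM: the crux is not vacuous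
  and its sector genuinely contains CM curves;
* `PGSelmerBSDNegative.strengthening_admissible_false` — **the natural strengthening "the prime can be
  taken ADMISSIBLE (`p ≥ 5`, good ordinary, `ρ̄_{W,p}` onto)" — the exact shape the route's `closes`
  obtains in the multiplicative sector (`hUBmult`) — is FALSE on this sector**: `32a2` has no odd
  prime of surjective mod-`p` image (`tamePinch_not_hasSurjectiveModNGaloisRep_quartic`, REUSED;
  Serre 1972 §4.5). `PGSelmerBSDNegative.strengthening_oddSurjective_false`: even "∃ odd `p` with
  `ρ̄` onto" fails. Consequence for planners/leads: the crux's `∃ p` must stay free of big-image side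
  conditions and every line through big-image tools needs a separate CM branch (as line
  `sector-split` has); this is the negatives-index pattern of stmt-15532 transported to this crux.

Refuter seat refuter-cdisprove-stmt-BirchSwinnertonDyer-17810-0, 2026-08-17.
-/

set_option linter.dupNamespace false

noncomputable section

open scoped Classical

namespace Summit.BirchSwinnertonDyer.BirchSwinnertonDyer.Theorems

open Literature.NumberTheory.EllipticCurves WeierstrassCurve

/-- `‖j(W)‖_q ≤ 1` excludes multiplicative reduction at `q` (contrapositive of
`one_lt_norm_j_of_hasMultiplicativeReductionAtPrime`, Silverman AEC VII.5.1(b)).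
[cite: SilvermanAEC2009, Prop. VII.5.1(b)] -/
theorem PGSelmerBSDNegative.not_hasMultiplicativeReductionAtPrime_of_norm_j_le_one
    (W : WeierstrassCurve ℚ) [W.IsElliptic] (q : ℕ) [Fact q.Prime] (h : ‖(W.j : ℚ_[q])‖ ≤ 1) :
    ¬ W.HasMultiplicativeReductionAtPrime q := fun hm =>
  (not_lt.mpr h) (one_lt_norm_j_of_hasMultiplicativeReductionAtPrime hm)

/-- **Integral `j` ⟹ no prime of multiplicative reduction** (`‖n‖_q ≤ 1` for `n ∈ ℤ` at every
prime `q`): every curve with `j ∈ ℤ` — in particular every CM curve — lies in the sector of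
`PGSelmerBSD`. [cite: SilvermanAEC2009, Prop. VII.5.1(b) and VII.5.5] -/
theorem PGSelmerBSDNegative.not_exists_multiplicative_of_j_eq_intCast (W : WeierstrassCurve ℚ)
    [W.IsElliptic] (n : ℤ) (hj : W.j = n) :
    ¬ ∃ (q : ℕ) (_ : Fact q.Prime), W.HasMultiplicativeReductionAtPrime q := by
  rintro ⟨q, hq, hm⟩
  refine PGSelmerBSDNegative.not_hasMultiplicativeReductionAtPrime_of_norm_j_le_one W q ?_ hm
  rw [hj, Rat.cast_intCast]
  exact Padic.norm_int_le_one n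

/-- `j(y² = x³ + Dx) = 1728` for `D ≠ 0` (`c₄ = −48D`, `Δ = −64D³`; Silverman AEC III.1). [folklore] -/
theorem PGSelmerBSDNegative.j_quartic {D : ℚ} [(⟨0, 0, 0, D, 0⟩ : WeierstrassCurve ℚ).IsElliptic] :
    (⟨0, 0, 0, D, 0⟩ : WeierstrassCurve ℚ).j = 1728 := by
  have hD : D ≠ 0 := by
    rintro rfl
    have hu := (⟨0, 0, 0, (0 : ℚ), 0⟩ : WeierstrassCurve ℚ).isUnit_Δ
    simp only [WeierstrassCurve.Δ, WeierstrassCurve.b₂, WeierstrassCurve.b₄, WeierstrassCurve.b₆,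
      WeierstrassCurve.b₈] at hu
    norm_num at hu
  have hΔ : (⟨0, 0, 0, D, 0⟩ : WeierstrassCurve ℚ).Δ = -64 * D ^ 3 := by
    simp only [WeierstrassCurve.Δ, WeierstrassCurve.b₂, WeierstrassCurve.b₄, WeierstrassCurve.b₆,
      WeierstrassCurve.b₈]
    ring
  have hc₄ : (⟨0, 0, 0, D, 0⟩ : WeierstrassCurve ℚ).c₄ = -48 * D := by
    simp only [WeierstrassCurve.c₄, WeierstrassCurve.b₂, WeierstrassCurve.b₄]
    ring
  rw [WeierstrassCurve.j, Units.val_inv_eq_inv_val, coe_Δ', hΔ, hc₄]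
  field_simp
  ring

/-- **`32a2 = [0,0,0,−1,0]` (`y² = x³ − x`) lies in the sector of the crux**: no prime of
multiplicative reduction (`j = 1728 ∈ ℤ`; its only bad prime `2` is additive). (`32a2` is elliptic by
the landed `isElliptic_quartic`; the same curve is `isElliptic_caseI_example` of the Smith files.)
[folklore] -/
theorem PGSelmerBSDNegative.thirtyTwoA2_no_multiplicative_prime :
    ¬ ∃ (q : ℕ) (_ : Fact q.Prime),
      (⟨0, 0, 0, -1, 0⟩ : WeierstrassCurve ℚ).HasMultiplicativeReductionAtPrime q := by
  haveI := isElliptic_quartic (D := (-1 : ℚ)) (by norm_num)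
  exact PGSelmerBSDNegative.not_exists_multiplicative_of_j_eq_intCast _ 1728
    (by rw [PGSelmerBSDNegative.j_quartic]; norm_num)

/-- **The hypotheses of `PGSelmerBSD` are jointly satisfiable** (the crux is not vacuous): `32a2` is
elliptic, globally minimal (`tamePinch_isGloballyMinimal_thirtyTwoA2`) and has no multiplicative
prime. [folklore] -/
theorem PGSelmerBSDNegative.hypotheses_satisfiable :
    ∃ (W : WeierstrassCurve ℚ) (_ : W.IsElliptic) (_ : W.IsGloballyMinimal),
      ¬ ∃ (q : ℕ) (_ : Fact q.Prime), W.HasMultiplicativeReductionAtPrime q :=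
  ⟨_, isElliptic_quartic (D := (-1 : ℚ)) (by norm_num), tamePinch_isGloballyMinimal_thirtyTwoA2,
    PGSelmerBSDNegative.thirtyTwoA2_no_multiplicative_prime⟩

/-- **The sector genuinely contains CM curves**: `32a2` is in it and has CM (`hasCM_of_j_eq_1728`),
so `¬ W.HasCM` can never be read off the crux's hypotheses. [folklore] -/
theorem PGSelmerBSDNegative.sector_meets_CM :
    ∃ (W : WeierstrassCurve ℚ) (_ : W.IsElliptic) (_ : W.IsGloballyMinimal),
      (¬ ∃ (q : ℕ) (_ : Fact q.Prime), W.HasMultiplicativeReductionAtPrime q) ∧ W.HasCM := by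
  haveI := isElliptic_quartic (D := (-1 : ℚ)) (by norm_num)
  exact ⟨⟨0, 0, 0, -1, 0⟩, ‹_›, tamePinch_isGloballyMinimal_thirtyTwoA2,
    PGSelmerBSDNegative.thirtyTwoA2_no_multiplicative_prime, hasCM_of_j_eq_1728 _ PGSelmerBSDNegative.j_quartic⟩

/-- **FALSE strengthening of the crux: an ADMISSIBLE prime.** "For every `W` in the sector there is a
prime `p ≥ 5`, good ordinary, with `ρ̄_{W,p}` surjective and `corank_p Sel_{p^∞}(W/ℚ) = r_an(W)`"
(the shape of the multiplicative branch `hUBmult` of `VerticalContact.closes`) is false: at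
`W = 32a2` no odd prime has surjective mod-`p` image (Serre 1972 §4.5;
`tamePinch_not_hasSurjectiveModNGaloisRep_quartic`). The crux survives only because its `∃ p`
carries no side condition. [cite: Serre1972, §4.5] -/
theorem PGSelmerBSDNegative.strengthening_admissible_false :
    ¬ ∀ (W : WeierstrassCurve ℚ) [W.IsElliptic] [W.IsGloballyMinimal],
        (¬ ∃ (q : ℕ) (_ : Fact q.Prime), W.HasMultiplicativeReductionAtPrime q) →
          ∃ (p : ℕ) (_ : Fact p.Prime), 5 ≤ p ∧ W.HasGoodReductionAtPrime p ∧
            ¬ (p : ℤ) ∣ W.frobeniusTrace p ∧ W.HasSurjectiveModNGaloisRep p ∧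
              W.selmerCorank p = W.analyticRank := by
  intro h
  obtain ⟨p, hp, h5, -, -, hsurj, -⟩ := @h ⟨0, 0, 0, -1, 0⟩ (isElliptic_quartic (by norm_num))
    tamePinch_isGloballyMinimal_thirtyTwoA2 PGSelmerBSDNegative.thirtyTwoA2_no_multiplicative_prime
  exact tamePinch_not_hasSurjectiveModNGaloisRep_quartic (D := -1) (by norm_num) p (by omega) hsurj

/-- **Even the weakest big-image clause fails on the sector**: "every `W` in the sector has an ODD
prime with `ρ̄_{W,p}` onto" is false at `32a2`, whatever is then asked of the Selmer corank.
[cite: Serre1972, §4.5] -/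
theorem PGSelmerBSDNegative.strengthening_oddSurjective_false :
    ¬ ∀ (W : WeierstrassCurve ℚ) [W.IsElliptic] [W.IsGloballyMinimal],
        (¬ ∃ (q : ℕ) (_ : Fact q.Prime), W.HasMultiplicativeReductionAtPrime q) →
          ∃ (p : ℕ) (_ : Fact p.Prime), p ≠ 2 ∧ W.HasSurjectiveModNGaloisRep p := by
  intro h
  obtain ⟨p, hp, h2, hsurj⟩ := @h ⟨0, 0, 0, -1, 0⟩ (isElliptic_quartic (by norm_num))
    tamePinch_isGloballyMinimal_thirtyTwoA2 PGSelmerBSDNegative.thirtyTwoA2_no_multiplicative_prime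
  exact tamePinch_not_hasSurjectiveModNGaloisRep_quartic (D := -1) (by norm_num) p h2 hsurj

end Summit.BirchSwinnertonDyer.BirchSwinnertonDyer.Theorems

end
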